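import Literature.AlgebraicGeometry.Resolution.WeightedCentreConstantField
import Mathlib.Algebra.MvPolynomial.PDeriv
import HarnessLib

/-!
# A derivation with a common `D`-constant factor in its data: `D = m • E`, `E m = 0 ⟹ D^b = m^b · E^b`
# (engine 1's `W(f)` toy model, RE-DERIVATION-eng1-g44 §3.2 L9 (iii) — an instrument, NOT a resolution theorem)

RE-DERIVATION-eng1-g44 §3.2, L9 ((L1′) toolkit, [R43] 3.11) (iii): "for generic `λ` the monomials of the leading derivation `𝔇_λ` share
ONE `Z″`-exponent `γ₀` (LEMMA generic weight, `WeightedCentreGenericWeight`), so `𝔇_λ = ε^{γ₀} · 𝔇₂` with `𝔇₂` having data in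
`k[ε_{M∖Z″}]`, and then `𝔇_λ^b = ε^{bγ₀} 𝔇₂^b`".  The general fact typed here: if a derivation `E` of a commutative algebra kills an
element `m` then `(m • E)^b(G) = m^b · E^b(G)` for every `G` and `b` (`derivation_smul_iterate_apply`); for polynomial rings, a derivation
`D` whose data are `D(ε_i) = m · E(ε_i)` IS `m • E` (`eq_smul_of_apply_X`), and `E m = 0` as soon as `m` involves only variables killed
by `E` (`apply_eq_zero_of_vars_subset`; for `m = ε^{γ₀}` with `γ₀` supported on `Z″` and `E = 𝔇₂` killing `ε_{Z″}` this is the engine's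
situation: `iterate_eq_pow_mul_iterate`).  No hypothesis on the characteristic, on weights or on nilpotency.

HONEST FRAMING.  Elementary commutative algebra ([Matsumura1987, §25]: derivations, Leibniz rule; statements OURS in this packaging);
an instrument for engine 1's `W(f)` TOY MODEL (the (L1′) step of the engine's THEOREM 𝔉′, which is NOT proved here).  NOT a resolution
theorem and NOT a statement about the invariant of [ATW2024].
-/

namespace Literature.AlgebraicGeometry.Resolution.WeightedBlowup

namespace LeadingMonomial

open MvPolynomial

/-! ## General algebras -/

section General

variable {R : Type*} [CommRing R] {A : Type*} [CommRing A] [Algebra R A] (E : Derivation R A A)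

/-- `E m = 0 ⟹ E (m^b) = 0` (derived here, Leibniz). [cite: Matsumura1987, §25] -/
theorem derivation_apply_pow_eq_zero {m : A} (hm : E m = 0) (b : ℕ) : E (m ^ b) = 0 := by
  rw [E.leibniz_pow, hm, smul_zero, smul_zero]

/-- **`(m • E)^b(G) = m^b · E^b(G)` when `E m = 0`** (derived here): a `D`-constant common factor of the data passes through all
iterates. [cite: Matsumura1987, §25] -/
theorem derivation_smul_iterate_apply {m : A} (hm : E m = 0) (b : ℕ) (G : A) : (m • E)^[b] G = m ^ b * E^[b] G := by
  induction b with
  | zero => rw [Function.iterate_zero, Function.iterate_zero, id_eq, pow_zero, one_mul]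
  | succ b ih =>
    rw [Function.iterate_succ_apply', Function.iterate_succ_apply', ih, Derivation.smul_apply, smul_eq_mul, E.leibniz,
      derivation_apply_pow_eq_zero E hm b, smul_zero, add_zero, smul_eq_mul, ← mul_assoc, pow_succ']

end General

/-! ## Polynomial rings -/

variable {K : Type*} [CommRing K] {σ : Type*} (D E : Derivation K (MvPolynomial σ K) (MvPolynomial σ K)) (m : MvPolynomial σ K)

/-- A derivation whose data are `D(ε_i) = m · E(ε_i)` IS `m • E` (derived here). [cite: Matsumura1987, §25] -/
theorem eq_smul_of_apply_X (h : ∀ i, D (X i) = m * E (X i)) : D = m • E :=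
  derivation_ext fun i => by rw [Derivation.smul_apply, smul_eq_mul, h]

variable [Fintype σ]

/-- A derivation kills every polynomial in the variables it kills (derived here; chain rule). [cite: Matsumura1987, §25] -/
theorem apply_eq_zero_of_vars_subset [DecidableEq σ] (Z : Set σ) (hE : ∀ z ∈ Z, E (X z) = 0) (hm : ∀ i ∈ m.vars, i ∈ Z) :
    E m = 0 := by
  rw [derivation_apply_eq_sum_pderiv_mul E m]
  refine Finset.sum_eq_zero fun i _ => ?_
  by_cases hi : i ∈ Z
  · rw [hE i hi, mul_zero]
  · rw [pderiv_eq_zero_of_notMem_vars (fun h => hi (hm i h)), zero_mul]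

/-- **L9 (iii)**: if `D(ε_i) = m · E(ε_i)` for all `i`, `E` kills the variables of a set `Z` and `m ∈ K[ε_Z]`, then
`D^b(G) = m^b · E^b(G)` for every `G` and `b` — the engine's `𝔇_λ^b = ε^{bγ₀} 𝔇₂^b` with `m = ε^{γ₀}`, `E = 𝔇₂` (derived here).
[cite: Matsumura1987, §25] -/
theorem iterate_eq_pow_mul_iterate [DecidableEq σ] (h : ∀ i, D (X i) = m * E (X i)) (Z : Set σ) (hE : ∀ z ∈ Z, E (X z) = 0)
    (hm : ∀ i ∈ m.vars, i ∈ Z) (b : ℕ) (G : MvPolynomial σ K) : D^[b] G = m ^ b * E^[b] G := by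
  rw [eq_smul_of_apply_X D E m h]
  exact derivation_smul_iterate_apply E (apply_eq_zero_of_vars_subset E m Z hE hm) b G

/-- The monomial case `m = ε^{γ₀}` with `γ₀` supported on `Z` (derived here). [cite: Matsumura1987, §25] -/
theorem iterate_eq_monomial_pow_mul_iterate [DecidableEq σ] {γ₀ : σ →₀ ℕ} (Z : Set σ) (hγ : ∀ i ∈ γ₀.support, i ∈ Z)
    (hE : ∀ z ∈ Z, E (X z) = 0) (h : ∀ i, D (X i) = monomial γ₀ 1 * E (X i)) (b : ℕ) (G : MvPolynomial σ K) :
    D^[b] G = monomial (b • γ₀) 1 * E^[b] G := by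
  have hm : ∀ i ∈ (monomial γ₀ (1 : K)).vars, i ∈ Z := fun i hi => by
    obtain ⟨d, hd, hid⟩ := (mem_vars_iff_mem_support i).mp hi
    rw [Finset.mem_singleton.mp (support_monomial_subset hd)] at hid
    exact hγ i hid
  rw [iterate_eq_pow_mul_iterate D E _ h Z hE hm b G, monomial_pow, one_pow]

end LeadingMonomial

end Literature.AlgebraicGeometry.Resolution.WeightedBlowup
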